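import Summits.BirchSwinnertonDyer.Rank1Residual.Additive.SignedTwistPlusKummerDictionary
import Summits.BirchSwinnertonDyer.Rank1Residual.Additive.SignedTwistSelmerLayer
import HarnessLib

/-!
# The PLUS Selmer dictionary of the signed-`η` twist at a finite layer:
# `c ∈ Sel⁺(W/ℚ_n) ↔ Θ_n c ∈ Sel⁺(V/K₀ℚ_n)` (cell `bsd-potss`, seat `bsd-potss-ctrl` g2; third brick
# of T-e2-R1⁺ = the plus twin of x1b's P5-4a `SignedTwistSelmerLayer` (D2); TARGET.md v6 §0.12 (e))

HONEST FRAMING (cell `bsd-potss`, run/shared/lean/pub/bsd-potss/; FULL-BSD rank ≤ 1 programme,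
tranche 1b): TOOL THEOREMS ONLY — no definition, no named Literature fact, no Summits-side fact
`def … : Prop`, no `sorry`, axioms standard; binders (`hD`, `hκ₀`, `hcop`, `[(galRange K₀).Normal]`,
`hη`) exactly as x1b's (D2); nothing is booked; no label / mark / count moves; nothing about (C1_η) or
`BSD(W, p)` is claimed.

## What
* `mem_localKummerOverOfEmb_strictSigned_one_iff` — (D4c⁺) restated on p17's abbreviation
  `strictSignedLocalPoints κ E W 1 n` (`E^{+,str} = E⁺`: `strictSignedLocalPointsOfEmb_one`).
* **`mem_strictSignedSelmerLayer_one_iff_h1TransportLayer`** — (D2⁺) at layer `n`: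
  `c ∈ Sel^{+,str}(W/ℚ_n) = Sel⁺(W/ℚ_n)` iff `Θ_n c ∈ Sel⁺(V/K₀ℚ_n)` (cc-typer-6's verbatim Def. 2.1
  object, sign `+`). Word for word x1b's (D2): classical part by `mem_selmerGroupOver_iff_h1Transport`
  + restriction / prime-to-`p` descent, the condition at `p` by (D4c⁺) at every conjugate `σ` (signs
  `η(σ)` invisible to membership).

References: [Kobayashi2003] Def. 1.1, Def. 2.1 (p. 5); [DokchitserDokchitserAnnals2010] Lemma 4.14;
[GreenbergLNM1716] §5 p. 143.
-/

noncomputable section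

open scoped Classical

open WeierstrassCurve Field

namespace Summit.BirchSwinnertonDyer.Rank1Residual.Additive.SignedTwist

open Literature.NumberTheory.EllipticCurves Literature.NumberTheory.GaloisRepresentations
  Literature.NumberTheory.EllipticCurves.Kobayashi2003
  Summit.BirchSwinnertonDyer.Rank1Residual.AdditivePotMult ZpExtension

variable (W : WeierstrassCurve ℚ) (K₀ : Type) [Field K₀] [NumberField K₀] {θ : K₀} {c : ℚ}
  (hθ : θ ∉ Set.range (algebraMap ℚ K₀)) (hc : θ ^ 2 = algebraMap ℚ K₀ c)
  (p : ℕ) [Fact p.Prime] (κ : ZpExtension ℚ p)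
  {V : WeierstrassCurve ℚ} {C : VariableChange ℚ} (hCV : C • W.quadraticTwist c = V)
  (E : Type) [Field E] [Algebra ℚ E]
  (η : absoluteGaloisGroup ℚ →* ℤˣ)
  (hη : ∀ σ : absoluteGaloisGroup ℚ, η σ = 1 ↔ σ • rootInClosure K₀ θ = rootInClosure K₀ θ)

include hθ hη in
/-- **(D4c⁺) on p17's abbreviation** `strictSignedLocalPoints κ E W 1 n = E^{+,str}_W(ℚ_n·E) =
E⁺_W(ℚ_n·E)` (`strictSignedLocalPointsOfEmb_one`). [cite: Kobayashi2003, Def. 1.1, Def. 2.1 (p. 5)] -/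
theorem mem_localKummerOverOfEmb_strictSigned_one_iff [(galRange (K := ℚ) K₀).Normal]
    (hD : ∀ g : absoluteGaloisGroup ℚ, ∃ τ : absoluteGaloisGroup E,
      (resGalOfEmb (closureEmb (K := ℚ) E) τ)⁻¹ * g ∈ towerTopSubgroup κ K₀)
    (hκ₀ : ∀ x, ∃ g ∈ galRange (K := ℚ) K₀, κ g = x)
    (hcop : (galRange (K := ℚ) K₀).index.Coprime p) (n : ℕ)
    (x : W.subgroupH1 p (κ.layerSubgroup n)) :
    x ∈ localKummerOverOfEmb W p (κ.layerSubgroup n) (closureEmb (K := ℚ) E)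
        (strictSignedLocalPoints κ E W 1 n) ↔
      h1TransportLayer W K₀ hθ hc p κ hCV n x ∈
        localKummerOverOfEmb V p (towerSubgroup κ K₀ n) (closureEmb (K := ℚ) E)
          (towerSignedLocalPointsOfEmb (towerSubgroup κ K₀) (closureEmb (K := ℚ) E) V 1 n) := by
  rw [show strictSignedLocalPoints κ E W 1 n = signedLocalPointsOfEmb κ (closureEmb (K := ℚ) E) W 1 n
    from strictSignedLocalPointsOfEmb_one κ (closureEmb (K := ℚ) E) W n]
  exact mem_localKummerOverOfEmb_signed_one_iff W K₀ hθ hc p κ hCV E η hη hD hκ₀ hcop n x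

include hη in
/-- **(D2⁺, finite layer) THE PLUS SELMER DICTIONARY at layer `n`**: `c ∈ Sel⁺(W/ℚ_n)` (p17's
`strictSignedSelmerLayer W κ E 1 n`; no strict clause on the plus side) iff `Θ_n c ∈ Sel⁺(V/K₀ℚ_n)`
(cc-typer-6, Kobayashi Def. 2.1 verbatim, sign `+`). Classical part: restriction + prime-to-`p`
descent (`relIndex_nsmul_mem_selmerGroupOver_of_resOfLe_mem_rel`, `[K₀ℚ_n : ℚ_n] ∣ [K₀ : ℚ]` prime
to `p`) + `mem_selmerGroupOver_iff_h1Transport`; at `p`: (D4c⁺) at every conjugate `σ`.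
[cite: Kobayashi2003, Def. 1.1, Def. 2.1 (p. 5)] [cite: GreenbergLNM1716, §5 p. 143] -/
theorem mem_strictSignedSelmerLayer_one_iff_h1TransportLayer [(galRange (K := ℚ) K₀).Normal]
    (hD : ∀ g : absoluteGaloisGroup ℚ, ∃ τ : absoluteGaloisGroup E,
      (resGalOfEmb (closureEmb (K := ℚ) E) τ)⁻¹ * g ∈ towerTopSubgroup κ K₀)
    (hκ₀ : ∀ x, ∃ g ∈ galRange (K := ℚ) K₀, κ g = x)
    (hcop : (galRange (K := ℚ) K₀).index.Coprime p) (n : ℕ)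
    (x : W.subgroupH1 p (κ.layerSubgroup n)) :
    x ∈ strictSignedSelmerLayer W κ E 1 n ↔
      h1TransportLayer W K₀ hθ hc p κ hCV n x ∈ towerSignedSelmerLayer V κ K₀ E 1 n := by
  have h1 := towerSubgroup_le_layerSubgroup K₀ p κ n
  have hclosed : IsClosed ((κ.layerSubgroup n : Subgroup (absoluteGaloisGroup ℚ)) :
      Set (absoluteGaloisGroup ℚ)) :=
    Subgroup.isClosed_of_isOpen _ (κ.isOpen_layerSubgroup n)
  -- the signs
  have hsign : ∀ (σ : absoluteGaloisGroup ℚ) (S : AddSubgroup (V.subgroupH1 p (towerSubgroup κ K₀ n))),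
      h1TransportLayer W K₀ hθ hc p κ hCV n (W.conjH1 p (κ.layerSubgroup n) σ x) ∈ S ↔
        V.conjH1 p (towerSubgroup κ K₀ n) σ (h1TransportLayer W K₀ hθ hc p κ hCV n x) ∈ S := by
    intro σ S
    rw [h1TransportLayer_conjH1 W K₀ hθ hc p κ hCV η hη]
    rcases Int.units_eq_one_or (η σ) with h | h
    · rw [h, Units.val_one, one_zsmul]
    · rw [h, Units.val_neg, Units.val_one, neg_one_zsmul, neg_mem_iff]
  rw [Additive.mem_strictSignedSelmerLayer_iff, Additive.mem_towerSignedSelmerLayer_iff]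
  constructor
  · rintro ⟨hsel, hp⟩
    refine ⟨?_, fun σ ↦ ?_⟩
    · rw [AddMonoidHom.comp_apply, AddMonoidHom.coe_coe,
        ← mem_selmerGroupOver_iff_h1Transport W K₀ hθ hc p hCV η hη]
      exact resOfLe_mem_selmerGroupOver W p h1 hsel
    · rw [← hsign,
        ← mem_localKummerOverOfEmb_strictSigned_one_iff W K₀ hθ hc p κ hCV E η hη hD hκ₀ hcop n]
      exact hp σ
  · rintro ⟨hsel, hp⟩
    refine ⟨?_, fun σ ↦ ?_⟩
    · rw [AddMonoidHom.comp_apply, AddMonoidHom.coe_coe,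
        ← mem_selmerGroupOver_iff_h1Transport W K₀ hθ hc p hCV η hη] at hsel
      haveI : ((towerSubgroup κ K₀ n).subgroupOf (κ.layerSubgroup n)).FiniteIndex :=
        ⟨fun h0 ↦ Subgroup.FiniteIndex.index_ne_zero (H := galRange (K := ℚ) K₀)
          (Nat.eq_zero_of_zero_dvd ((show (towerSubgroup κ K₀ n).relIndex (κ.layerSubgroup n) = 0
            from h0) ▸ relIndex_tower_layer_dvd K₀ p κ n))⟩
      have hd := relIndex_nsmul_mem_selmerGroupOver_of_resOfLe_mem_rel W p h1 (isOpen_galRange K₀)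
        rfl hsel
      obtain ⟨j, hj⟩ := exists_pow_nsmul_eq_zero_subgroupH1_of_isClosed W p hclosed x
      exact mem_of_coprime_nsmul_mem p _ hj
        (Nat.Coprime.coprime_dvd_left (relIndex_tower_layer_dvd K₀ p κ n) hcop) hd
    · rw [mem_localKummerOverOfEmb_strictSigned_one_iff W K₀ hθ hc p κ hCV E η hη hD hκ₀ hcop n,
        hsign]
      exact hp σ

end Summit.BirchSwinnertonDyer.Rank1Residual.Additive.SignedTwist

end
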